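import Literature.NumberTheory.Rogawski1990.LocalTransferGlue              -- ★ `stableOrbitalIntegralRel`, `IsDeltaTransferRel`, `IsLocSmooth.indicator`, BZ refinement
import Literature.NumberTheory.Rogawski1990.LocalTransferRegularCutoff     -- ★ p840604 F0P3a-p08 (g13): `classOrbitalIntegral_congr_of_forall_conj` (orbit-wise congruence; cited, not restated)
import HarnessLib

/-!
# «A LOCAL STABLE ORBITAL INTEGRAL IS A STABLE ORBITAL INTEGRAL» — the `H`-side glue of Langlands–Shelstad's descent
(Langlands–Shelstad, *Descent for transfer factors* §2.2 Lemma 2.2.A; Rogawski 1990 §4.3 (4.3.1), §4.9; Bernstein–Zelevinsky 1976 §1.1)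

Topic `NumberTheory/Rogawski1990`; namespace `Literature.NumberTheory.Rogawski1990`.  THEOREMS ONLY (no definition, no instance, no
notation, no named fact, no `sorry`); GENERIC (an abstract group `A` with a «stable conjugacy» relation `st`, a «regular» predicate `reg`, an
orbital measure family `m`, and an INVARIANT MAP `π : A → C` to a Hausdorff, totally disconnected, locally compact «class space» `C` — in the
application `A = H(F)` for a non-archimedean `F`, `π` = the characteristic-polynomial datum, `C` = a finite product of copies of `F`).
Cell `pub/hodgecm-mathlib` (D-0151), crux H413 = stmt-HodgeConjecture-24833, F0∕P3a road «D-N6-ns», floor-2 line candidate «N6nsGerm»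
(A-p12 (g18), LEAD F0P3a-plan (g9) T8-35 (A)), stub `stub_N6nsGlue`; seat B-p08 (g26).  HONEST LABEL: HC_CM is proved only modulo the 2 remaining
named inputs (hLiu418, h413) until rung 0 closes; this file proves no letter — it is the abstract «partition of unity over the class space» step that
reduces «`R` is the stable orbital integral of SOME test function» to «`R` is one LOCALLY over the class space» [LanglandsShelstad1990Descent, Lemma 2.2.A].

THE MATHEMATICS (loc. cit. p. 10–11, transposed to an abstract class map).  Let `R : A → ℂ` («`Φ^st`») vanish at the regular `a` with `π a ∉ K`,
`K ⊆ C` compact («compactly supported modulo conjugation»), and suppose that every point `c ∈ K` has an OPEN neighbourhood `W ⊆ C` and a test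
function `ψ_W` with `Φ^st(a, ψ_W) = R(a)` at every regular `a` with `π a ∈ W` («local stable orbital integral», in the SATURATED form that the
quasi-split saturation step of loc. cit. produces from locality near a point — §4 `forall_stableOrbitalIntegralRel_eq_of_saturation`).  Refine the
cover of `K` into finitely many pairwise DISJOINT compact open `V_j ⊆ W_{c_j}` (Bernstein–Zelevinsky's Lemma 1.1, ★
`Literature.Topology.exists_finite_disjoint_compactOpen_cover_of_isCompact`) and put `φ^H := Σ_j 1_{π⁻¹ V_j} · ψ_{c_j}` («multiplying a given
function by the characteristic function of such a [stably invariant open] set», p. 11).  Because `π` is constant on conjugacy classes and on the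
stable class of a regular element, `π⁻¹ V_j` is a union of whole stable classes, so at a regular `a` with `π a ∈ V_j` the function `φ^H` agrees with
`ψ_{c_j}` on EVERY orbit in the stable class of `a`, whence `Φ^st(a, φ^H) = Φ^st(a, ψ_{c_j}) = R(a)`; at a regular `a` with `π a ∉ ⋃ V_j ⊇ K` both
sides vanish.  NO additivity and NO integrability of orbital integrals is used (disjointness makes the sum collapse orbit-wise), so the measure
family `m` is arbitrary.

* §1 orbit-wise congruence of STABLE orbital integrals (over ★ `classOrbitalIntegral_congr_of_forall_conj`, F0P3a-p08 (g13) p840604):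
  `stableOrbitalIntegralRel_congr_fun_of_eqOn`, `stableOrbitalIntegralRel_eq_zero_of_eqOn_zero`.
* §2 saturated cut-offs: `stableOrbitalIntegralRel_indicator_preimage`, `stableOrbitalIntegralRel_sum_indicator_preimage_of_mem`,
  `stableOrbitalIntegralRel_sum_indicator_preimage_of_notMem`.
* §3 THE GLUE: `exists_stableOrbitalIntegralRel_eq_of_locally` (abstract class `PH` of test functions closed under `0`, `+`, and saturated compact-open
  cut-offs), `exists_isLocSmooth_stableOrbitalIntegralRel_eq_of_locally` (`PH = IsLocSmooth`, `π` continuous), `…_of_locally_of_isCompact` (the compact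
  read in the group `A`: `K := π '' K_A`), and the (4.3.1) dress
  `exists_isDeltaTransferRel_of_locally` (`R = Σ_{[γ]} Δ(·, γ) Φ([γ], φ)`).
* §4 from POINTWISE locality + SATURATION to saturated locality: `forall_stableOrbitalIntegralRel_eq_of_saturation`,
  `exists_stableOrbitalIntegralRel_eq_of_pointwise_of_saturation`.

## References
* [LanglandsShelstad1990Descent] R. P. Langlands, D. Shelstad, *Descent for transfer factors*, The Grothendieck Festschrift II, Progr. Math. 87
  (1990), §2.2 Lemma 2.2.A pp. 10–11 (in the 2007 reprint pagination of the held text).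
* [Rogawski1990] J. D. Rogawski, *Automorphic Representations of Unitary Groups in Three Variables*, Ann. of Math. Stud. 123 (1990): §4.1 (4.1.1)
  p. 39, §4.3 (4.3.1) p. 43, §4.9 Prop. 4.9.1 (a) p. 55.
* [BernsteinZelevinsky1976] I. N. Bernstein, A. V. Zelevinsky, *Representations of the group GL(n, F) where F is a non-archimedean local field*,
  Russian Math. Surveys 31:3 (1976), §1.1 Lemma 1.1.
-/

set_option autoImplicit false

noncomputable section

open Set Filter Topology MeasureTheory
open scoped Function

namespace Literature.NumberTheory.Rogawski1990

open Literature.NumberTheory.Automorphic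

/-! ## §1 Orbit-wise congruence of stable orbital integrals — no measure hypothesis (class level: ★ `classOrbitalIntegral_congr_of_forall_conj`) -/

section StableCongr

variable {A : Type*} [Group A] [∀ a : A, MeasurableSpace (A ⧸ Subgroup.centralizer ({a} : Set A))]

/-- **`Φ^st(a, f) = Φ^st(a, g)` when `f = g` on a set `S` containing every conjugate of every `b` with `st a b`** (the union of the orbits
in the «stable class» of `a`): the stable orbital integral ★ `stableOrbitalIntegralRel` is the `finsum` of class orbital integrals over the classes
`c` with `st a (out c)`, and each of them only sees `f` on the orbit of `out c` (★ `classOrbitalIntegral_congr_of_forall_conj`). [cite: Rogawski1990, §4.1 (4.1.1) p. 39] -/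
theorem stableOrbitalIntegralRel_congr_fun_of_eqOn {st : A → A → Prop} (m : OrbitalMeasureFamily A) {f g : A → ℂ} {a : A} (S : Set A)
    (hS : ∀ b : A, st a b → ∀ y : A, y * b * y⁻¹ ∈ S) (hfg : EqOn f g S) :
    stableOrbitalIntegralRel st m f a = stableOrbitalIntegralRel st m g a := by
  rw [stableOrbitalIntegralRel_def, stableOrbitalIntegralRel_def]
  exact finsum_mem_congr rfl fun c hc => classOrbitalIntegral_congr_of_forall_conj m c fun y => hfg (hS _ hc y)

/-- **`Φ^st(a, f) = 0` when `f` vanishes on a set `S` containing every conjugate of every `b` with `st a b`.** [cite: Rogawski1990, §4.1 (4.1.1) p. 39] -/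
theorem stableOrbitalIntegralRel_eq_zero_of_eqOn_zero {st : A → A → Prop} (m : OrbitalMeasureFamily A) {f : A → ℂ} {a : A} (S : Set A)
    (hS : ∀ b : A, st a b → ∀ y : A, y * b * y⁻¹ ∈ S) (hf : ∀ b ∈ S, f b = 0) :
    stableOrbitalIntegralRel st m f a = 0 := by
  rw [← stableOrbitalIntegralRel_zero st m a]
  exact stableOrbitalIntegralRel_congr_fun_of_eqOn m S hS fun b hb => hf b hb

end StableCongr

/-! ## §2 Cut-offs along an invariant class map `π : A → C` («multiplying by the characteristic function of a stably invariant set») -/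

section CutOff

variable {A : Type*} [Group A] [∀ a : A, MeasurableSpace (A ⧸ Subgroup.centralizer ({a} : Set A))] {C : Type*}

/-- **`Φ^st(a, 1_{π⁻¹ W} · ψ) = 1_W(π a) · Φ^st(a, ψ)`** for a class map `π` constant on conjugacy classes (`hπ`) and on the `st`-class of `a`
(`hπst`): the saturated set `π⁻¹ W` contains, or misses, every orbit of the stable class of `a` at once. [cite: LanglandsShelstad1990Descent, §2.2 p. 11]
[cite: Rogawski1990, §4.1 (4.1.1) p. 39] -/
theorem stableOrbitalIntegralRel_indicator_preimage {st : A → A → Prop} (m : OrbitalMeasureFamily A) (π : A → C)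
    (hπ : ∀ b y : A, π (y * b * y⁻¹) = π b) {a : A} (hπst : ∀ b : A, st a b → π b = π a) (W : Set C) (ψ : A → ℂ) :
    stableOrbitalIntegralRel st m ((π ⁻¹' W).indicator ψ) a = W.indicator (fun _ => stableOrbitalIntegralRel st m ψ a) (π a) := by
  by_cases hW : π a ∈ W
  · rw [Set.indicator_of_mem hW]
    refine stableOrbitalIntegralRel_congr_fun_of_eqOn m (π ⁻¹' W) (fun b hb y => ?_) fun b hb => Set.indicator_of_mem hb ψ
    show π (y * b * y⁻¹) ∈ W
    rw [hπ, hπst b hb]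
    exact hW
  · rw [Set.indicator_of_notMem hW]
    refine stableOrbitalIntegralRel_eq_zero_of_eqOn_zero m (π ⁻¹' W)ᶜ (fun b hb y => ?_) fun b hb => Set.indicator_of_notMem hb ψ
    show π (y * b * y⁻¹) ∉ W
    rw [hπ, hπst b hb]
    exact hW

/-- **At a regular `a` with `π a ∈ V_j`, the glued function `Σ_i 1_{π⁻¹ V_i} · ψ_i` (pairwise disjoint `V_i`) has `Φ^st(a, ·) = Φ^st(a, ψ_j)`**:
on the saturated set `π⁻¹ V_j` (a union of whole orbits of the stable class of `a`) the sum IS `ψ_j`; no additivity of orbital integrals is used.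
[cite: LanglandsShelstad1990Descent, §2.2 p. 11] [cite: BernsteinZelevinsky1976, §1.1] -/
theorem stableOrbitalIntegralRel_sum_indicator_preimage_of_mem {st : A → A → Prop} (m : OrbitalMeasureFamily A) (π : A → C)
    (hπ : ∀ b y : A, π (y * b * y⁻¹) = π b) {a : A} (hπst : ∀ b : A, st a b → π b = π a) {n : ℕ} (V : Fin n → Set C)
    (hV : Pairwise (Disjoint on V)) (ψ : Fin n → A → ℂ) {j : Fin n} (hj : π a ∈ V j) :
    stableOrbitalIntegralRel st m (∑ i, (π ⁻¹' V i).indicator (ψ i)) a = stableOrbitalIntegralRel st m (ψ j) a := by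
  refine stableOrbitalIntegralRel_congr_fun_of_eqOn m (π ⁻¹' V j) (fun b hb y => ?_) fun b hb => ?_
  · show π (y * b * y⁻¹) ∈ V j
    rw [hπ, hπst b hb]
    exact hj
  · show (∑ i, (π ⁻¹' V i).indicator (ψ i)) b = ψ j b
    rw [Finset.sum_apply, Finset.sum_eq_single j]
    · exact Set.indicator_of_mem hb _
    · intro i _ hij
      exact Set.indicator_of_notMem (fun hbi : b ∈ π ⁻¹' V i => Set.disjoint_left.1 (hV hij) (Set.mem_preimage.1 hbi) hb) _
    · exact fun h => absurd (Finset.mem_univ j) h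

/-- **At a regular `a` with `π a ∉ ⋃_i V_i`, `Φ^st(a, Σ_i 1_{π⁻¹ V_i} · ψ_i) = 0`**: the glued function vanishes on the fibre `π⁻¹ {π a}`, which
contains every orbit of the stable class of `a`. [cite: LanglandsShelstad1990Descent, §2.2 p. 11] -/
theorem stableOrbitalIntegralRel_sum_indicator_preimage_of_notMem {st : A → A → Prop} (m : OrbitalMeasureFamily A) (π : A → C)
    (hπ : ∀ b y : A, π (y * b * y⁻¹) = π b) {a : A} (hπst : ∀ b : A, st a b → π b = π a) {n : ℕ} (V : Fin n → Set C)
    (ψ : Fin n → A → ℂ) (ha : π a ∉ ⋃ i, V i) :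
    stableOrbitalIntegralRel st m (∑ i, (π ⁻¹' V i).indicator (ψ i)) a = 0 := by
  refine stableOrbitalIntegralRel_eq_zero_of_eqOn_zero m {b : A | π b = π a} (fun b hb y => ?_) fun b hb => ?_
  · show π (y * b * y⁻¹) = π a
    rw [hπ, hπst b hb]
  · show (∑ i, (π ⁻¹' V i).indicator (ψ i)) b = 0
    rw [Finset.sum_apply]
    refine Finset.sum_eq_zero fun i _ => Set.indicator_of_notMem (fun hbi : b ∈ π ⁻¹' V i => ha ?_) _
    have hb' : π b = π a := hb
    exact Set.mem_iUnion.2 ⟨i, by rw [← hb']; exact Set.mem_preimage.1 hbi⟩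

end CutOff

/-! ## §3 THE GLUE [LanglandsShelstad1990Descent, Lemma 2.2.A]: a local stable orbital integral is a stable orbital integral -/

section Glue

variable {A : Type*} [Group A] [∀ a : A, MeasurableSpace (A ⧸ Subgroup.centralizer ({a} : Set A))]
  {C : Type*} [TopologicalSpace C] [T2Space C] [TotallyDisconnectedSpace C] [LocallyCompactSpace C]

/-- **«A LOCAL STABLE ORBITAL INTEGRAL IS A STABLE ORBITAL INTEGRAL», abstract form.**  Data: a «stable conjugacy» `st`, a «regular» predicate
`reg`, ANY orbital measure family `m`, a class map `π : A → C` to a Hausdorff totally disconnected locally compact space, constant on conjugacy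
classes (`hπ`) and on the `st`-class of every regular element (`hπst`); a class `PH` of test functions containing `0`, closed under `+` and under
the cut-offs `ψ ↦ 1_{π⁻¹ W} · ψ` by compact open `W ⊆ C`.  Hypotheses on the target `R` («`Φ^st`»): it vanishes at the regular `a` with `π a`
outside a compact `K` (compact support modulo conjugation), and every `c ∈ K` has an open `W ∋ c` and a `ψ ∈ PH` with `Φ^st(a, ψ) = R a` at every
regular `a` with `π a ∈ W` (locality, saturated form).  Conclusion: ONE `φ^H ∈ PH` with `Φ^st(a, φ^H) = R a` at every regular `a` — namely
`φ^H = Σ_j 1_{π⁻¹ V_j} · ψ_j` over a finite disjoint compact-open refinement `V_j` of the cover of `K` (★ Bernstein–Zelevinsky Lemma 1.1).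
[cite: LanglandsShelstad1990Descent, §2.2 Lemma 2.2.A pp. 10–11] [cite: BernsteinZelevinsky1976, §1.1] [cite: Rogawski1990, §4.9 Prop. 4.9.1 (a) p. 55] -/
theorem exists_stableOrbitalIntegralRel_eq_of_locally (st : A → A → Prop) (reg : A → Prop) (m : OrbitalMeasureFamily A) (π : A → C)
    (hπ : ∀ b y : A, π (y * b * y⁻¹) = π b) (hπst : ∀ a b : A, reg a → st a b → π b = π a)
    (PH : (A → ℂ) → Prop) (hPH0 : PH 0) (hPHadd : ∀ F G : A → ℂ, PH F → PH G → PH (F + G))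
    (hPHcut : ∀ (ψ : A → ℂ) (W : Set C), PH ψ → IsCompact W → IsOpen W → PH ((π ⁻¹' W).indicator ψ))
    (R : A → ℂ) (K : Set C) (hK : IsCompact K) (hRK : ∀ a : A, reg a → π a ∉ K → R a = 0)
    (hloc : ∀ c ∈ K, ∃ (W : Set C) (ψ : A → ℂ), IsOpen W ∧ c ∈ W ∧ PH ψ ∧
      ∀ a : A, reg a → π a ∈ W → stableOrbitalIntegralRel st m ψ a = R a) :
    ∃ φH : A → ℂ, PH φH ∧ ∀ a : A, reg a → stableOrbitalIntegralRel st m φH a = R a := by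
  classical
  choose W ψ hWo hcW hψ hWR using hloc
  -- Bernstein–Zelevinsky: a finite disjoint compact-open refinement of the cover `(W c)_{c ∈ K}` of `K`
  obtain ⟨n, V, hV, hVd, hKV⟩ := Literature.Topology.exists_finite_disjoint_compactOpen_cover_of_isCompact hK
    (fun k : K => W k.1 k.2) (fun k => hWo k.1 k.2) fun c hc => Set.mem_iUnion.2 ⟨⟨c, hc⟩, hcW c hc⟩
  choose hVc hVo _hVne k hk using hV
  refine ⟨∑ j, (π ⁻¹' V j).indicator (ψ (k j).1 (k j).2), ?_, fun a ha => ?_⟩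
  · exact Finset.sum_induction _ PH (fun F G hF hG => hPHadd F G hF hG) hPH0
      fun j _ => hPHcut _ _ (hψ (k j).1 (k j).2) (hVc j) (hVo j)
  · by_cases hmem : π a ∈ ⋃ j, V j
    · obtain ⟨j, hj⟩ := Set.mem_iUnion.1 hmem
      rw [stableOrbitalIntegralRel_sum_indicator_preimage_of_mem m π hπ (fun b hb => hπst a b ha hb) V hVd _ hj]
      exact hWR (k j).1 (k j).2 a ha (hk j hj)
    · rw [stableOrbitalIntegralRel_sum_indicator_preimage_of_notMem m π hπ (fun b hb => hπst a b ha hb) V _ hmem]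
      exact (hRK a ha fun hKa => hmem (hKV hKa)).symm

/-- **The glue for `C_c^∞` test functions** (`PH = IsLocSmooth`: locally constant, compactly supported): `A` a topological space and `π`
CONTINUOUS, so that the cut-offs `1_{π⁻¹ W} · ψ` by compact open `W` stay in `C_c^∞` (★ `IsLocSmooth.indicator`; `π⁻¹ W` is clopen).
[cite: LanglandsShelstad1990Descent, §2.2 Lemma 2.2.A pp. 10–11] [cite: Rogawski1990, §1.6 p. 6; §4.9 Prop. 4.9.1 (a) p. 55] -/
theorem exists_isLocSmooth_stableOrbitalIntegralRel_eq_of_locally [TopologicalSpace A] (st : A → A → Prop) (reg : A → Prop)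
    (m : OrbitalMeasureFamily A) (π : A → C) (hπc : Continuous π)
    (hπ : ∀ b y : A, π (y * b * y⁻¹) = π b) (hπst : ∀ a b : A, reg a → st a b → π b = π a)
    (R : A → ℂ) (K : Set C) (hK : IsCompact K) (hRK : ∀ a : A, reg a → π a ∉ K → R a = 0)
    (hloc : ∀ c ∈ K, ∃ (W : Set C) (ψ : A → ℂ), IsOpen W ∧ c ∈ W ∧ IsLocSmooth ψ ∧
      ∀ a : A, reg a → π a ∈ W → stableOrbitalIntegralRel st m ψ a = R a) :
    ∃ φH : A → ℂ, IsLocSmooth φH ∧ ∀ a : A, reg a → stableOrbitalIntegralRel st m φH a = R a :=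
  exists_stableOrbitalIntegralRel_eq_of_locally st reg m π hπ hπst IsLocSmooth isLocSmooth_zero (fun _ _ hF hG => hF.add hG)
    (fun _ _ hψ hWc hWo => hψ.indicator ⟨hWc.isClosed.preimage hπc, hWo.preimage hπc⟩) R K hK hRK hloc

/-- **The glue with «compact support modulo conjugation» read IN THE GROUP** (print's phrasing: `R` vanishes along every regular stable class that
does not meet a fixed compact `K_A ⊆ A`), `A` a topological space and `π` continuous: take `K := π '' K_A` in
`exists_stableOrbitalIntegralRel_eq_of_locally`; locality is then asked at (the class of) every point of `K_A`.
[cite: LanglandsShelstad1990Descent, §2.2 Lemma 2.2.A pp. 10–11] [cite: Rogawski1990, §4.9 Prop. 4.9.1 (a) p. 55] -/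
theorem exists_stableOrbitalIntegralRel_eq_of_locally_of_isCompact [TopologicalSpace A] (st : A → A → Prop) (reg : A → Prop)
    (m : OrbitalMeasureFamily A) (π : A → C) (hπc : Continuous π)
    (hπ : ∀ b y : A, π (y * b * y⁻¹) = π b) (hπst : ∀ a b : A, reg a → st a b → π b = π a)
    (PH : (A → ℂ) → Prop) (hPH0 : PH 0) (hPHadd : ∀ F G : A → ℂ, PH F → PH G → PH (F + G))
    (hPHcut : ∀ (ψ : A → ℂ) (W : Set C), PH ψ → IsCompact W → IsOpen W → PH ((π ⁻¹' W).indicator ψ))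
    (R : A → ℂ) (KA : Set A) (hKA : IsCompact KA) (hRKA : ∀ a : A, reg a → (∀ b ∈ KA, ¬ st a b) → R a = 0)
    (hloc : ∀ b ∈ KA, ∃ (W : Set C) (ψ : A → ℂ), IsOpen W ∧ π b ∈ W ∧ PH ψ ∧
      ∀ a : A, reg a → π a ∈ W → stableOrbitalIntegralRel st m ψ a = R a) :
    ∃ φH : A → ℂ, PH φH ∧ ∀ a : A, reg a → stableOrbitalIntegralRel st m φH a = R a := by
  refine exists_stableOrbitalIntegralRel_eq_of_locally st reg m π hπ hπst PH hPH0 hPHadd hPHcut R (π '' KA) (hKA.image hπc)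
    (fun a ha hπa => hRKA a ha fun b hb hab => hπa ⟨b, hb, hπst a b ha hab⟩) fun c hc => ?_
  obtain ⟨b, hb, rfl⟩ := hc
  exact hloc b hb

variable {B : Type*} [Group B] [∀ b : B, MeasurableSpace (B ⧸ Subgroup.centralizer ({b} : Set B))]

/-- **The glue in (4.3.1) dress**: with `R(γ_H) := Σ_{[γ]} Δ(γ_H, γ) Φ([γ], φ)` the right side of ★ `IsDeltaTransferRel` for a transfer factor
`T` and a function `φ` on `B` («`G`»), local (saturated) transfers `ψ` of `φ` over the class space of `A` («`H`») glue to a transfer `φ^H ∈ PH`: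
`IsDeltaTransferRel Rm st reg T m mG φ^H φ`. [cite: Rogawski1990, §4.3 (4.3.1) p. 43; §4.9 Prop. 4.9.1 (a) p. 55] [cite: LanglandsShelstad1990Descent, §2.2 Lemma 2.2.A pp. 10–11] -/
theorem exists_isDeltaTransferRel_of_locally {Rm : A → B → Prop} (st : A → A → Prop) (reg : A → Prop) (T : TransferFactorData A B Rm)
    (m : OrbitalMeasureFamily A) (mG : OrbitalMeasureFamily B) (π : A → C)
    (hπ : ∀ b y : A, π (y * b * y⁻¹) = π b) (hπst : ∀ a b : A, reg a → st a b → π b = π a)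
    (PH : (A → ℂ) → Prop) (hPH0 : PH 0) (hPHadd : ∀ F G : A → ℂ, PH F → PH G → PH (F + G))
    (hPHcut : ∀ (ψ : A → ℂ) (W : Set C), PH ψ → IsCompact W → IsOpen W → PH ((π ⁻¹' W).indicator ψ))
    (φ : B → ℂ) (K : Set C) (hK : IsCompact K)
    (hRK : ∀ a : A, reg a → π a ∉ K → ∑ᶠ c : ConjClasses B, T.Δ a (Quotient.out c) * classOrbitalIntegral mG φ c = 0)
    (hloc : ∀ c ∈ K, ∃ (W : Set C) (ψ : A → ℂ), IsOpen W ∧ c ∈ W ∧ PH ψ ∧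
      ∀ a : A, reg a → π a ∈ W →
        stableOrbitalIntegralRel st m ψ a = ∑ᶠ c : ConjClasses B, T.Δ a (Quotient.out c) * classOrbitalIntegral mG φ c) :
    ∃ φH : A → ℂ, PH φH ∧ IsDeltaTransferRel Rm st reg T m mG φH φ :=
  exists_stableOrbitalIntegralRel_eq_of_locally st reg m π hπ hπst PH hPH0 hPHadd hPHcut
    (fun a => ∑ᶠ c : ConjClasses B, T.Δ a (Quotient.out c) * classOrbitalIntegral mG φ c) K hK hRK hloc

omit [∀ a : A, MeasurableSpace (A ⧸ Subgroup.centralizer ({a} : Set A))] in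
/-- **The (4.3.1) right side `R_φ(γ_H) = Σ_{[γ]} Δ(γ_H, γ) Φ([γ], φ)` VANISHES at `γ_H`** as soon as every class `[γ]` either has `Δ(γ_H, γ) = 0` or
misses the support of `φ` along its whole orbit — the abstract form of «compactly supported modulo conjugation» for `R_φ`.
[cite: Rogawski1990, §4.3 (4.3.1)–(4.3.2) p. 43] [cite: LanglandsShelstad1990Descent, §2.2 p. 10] -/
theorem finsum_delta_mul_classOrbitalIntegral_eq_zero_of_forall {Rm : A → B → Prop} (T : TransferFactorData A B Rm)
    (mG : OrbitalMeasureFamily B) (φ : B → ℂ) (a : A)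
    (h : ∀ c : ConjClasses B, T.Δ a (Quotient.out c) = 0 ∨ ∀ y : B, φ (y * Quotient.out c * y⁻¹) = 0) :
    ∑ᶠ c : ConjClasses B, T.Δ a (Quotient.out c) * classOrbitalIntegral mG φ c = 0 := by
  refine finsum_eq_zero_of_forall_eq_zero fun c => ?_
  rcases h c with hΔ | hφ
  · rw [hΔ, zero_mul]
  · rw [classOrbitalIntegral_congr_of_forall_conj mG c (F' := (0 : B → ℂ)) fun y => by rw [hφ y, Pi.zero_apply],
      classOrbitalIntegral_zero_fun, mul_zero]

end Glue

/-! ## §4 From POINTWISE locality + SATURATION to saturated locality («because `G` is quasisplit», loc. cit. p. 11) -/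

section Saturation

variable {A : Type*} [Group A] [∀ a : A, MeasurableSpace (A ⧸ Subgroup.centralizer ({a} : Set A))] {C : Type*}

/-- **Saturation step.**  If `st` is class-respecting (`hst`: `st a b` forces `st a · = st b ·`), `reg` and `R` are `st`-invariant, `ψ` realises `R`
on a set `V` («near `ε`»: `Φ^st(γ, ψ) = R γ` for regular `γ ∈ V`), and every regular `γ` with `π γ ∈ W` is `st`-conjugate INTO `V` (SATURATION —
«any regular `γ` close to `ε′` is stably conjugate to a `γ` close to `ε` because `G` is quasisplit»), then `ψ` realises `R` on the whole
saturated set `π⁻¹ W ∩ reg`. [cite: LanglandsShelstad1990Descent, §2.2 p. 11] [cite: Rogawski1990, §4.1 (4.1.1) p. 40] -/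
theorem forall_stableOrbitalIntegralRel_eq_of_saturation {st : A → A → Prop} {reg : A → Prop} (m : OrbitalMeasureFamily A) (π : A → C)
    (hst : ∀ a b : A, st a b → ∀ e : A, st a e ↔ st b e) (hreg : ∀ a b : A, reg a → st a b → reg b)
    {R : A → ℂ} (hR : ∀ a b : A, reg a → st a b → R b = R a) {V : Set A} {W : Set C} {ψ : A → ℂ}
    (hV : ∀ γ ∈ V, reg γ → stableOrbitalIntegralRel st m ψ γ = R γ)
    (hsat : ∀ γ : A, reg γ → π γ ∈ W → ∃ γ' ∈ V, st γ γ') :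
    ∀ γ : A, reg γ → π γ ∈ W → stableOrbitalIntegralRel st m ψ γ = R γ := by
  intro γ hγ hγW
  obtain ⟨γ', hγ'V, hγγ'⟩ := hsat γ hγ hγW
  rw [stableOrbitalIntegralRel_congr (hst γ γ' hγγ') m ψ, hV γ' hγ'V (hreg γ γ' hγ hγγ'), hR γ γ' hγ hγγ']

variable [TopologicalSpace C] [T2Space C] [TotallyDisconnectedSpace C] [LocallyCompactSpace C]

/-- **Lemma 2.2.A with the hypotheses in PRINT'S shape**: `R` stably invariant on the regular set, compactly supported modulo conjugation
(`K`), and at (a representative `ε` over) every point of `K` a test function `ψ ∈ PH` realising `R` on some set `V ∋` the nearby regular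
elements, TOGETHER WITH the saturation datum: an open `W ∋ c` in the class space all of whose regular fibres are `st`-conjugate into `V`.
Then `R = Φ^st(·, φ^H)` on the regular set for one `φ^H ∈ PH`. [cite: LanglandsShelstad1990Descent, §2.2 Lemma 2.2.A pp. 10–11]
[cite: Rogawski1990, §4.9 Prop. 4.9.1 (a) p. 55] -/
theorem exists_stableOrbitalIntegralRel_eq_of_pointwise_of_saturation (st : A → A → Prop) (reg : A → Prop) (m : OrbitalMeasureFamily A)
    (π : A → C) (hπ : ∀ b y : A, π (y * b * y⁻¹) = π b) (hπst : ∀ a b : A, reg a → st a b → π b = π a)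
    (hst : ∀ a b : A, st a b → ∀ e : A, st a e ↔ st b e) (hreg : ∀ a b : A, reg a → st a b → reg b)
    (PH : (A → ℂ) → Prop) (hPH0 : PH 0) (hPHadd : ∀ F G : A → ℂ, PH F → PH G → PH (F + G))
    (hPHcut : ∀ (ψ : A → ℂ) (W : Set C), PH ψ → IsCompact W → IsOpen W → PH ((π ⁻¹' W).indicator ψ))
    (R : A → ℂ) (hR : ∀ a b : A, reg a → st a b → R b = R a) (K : Set C) (hK : IsCompact K)
    (hRK : ∀ a : A, reg a → π a ∉ K → R a = 0)
    (hloc : ∀ c ∈ K, ∃ (V : Set A) (W : Set C) (ψ : A → ℂ), IsOpen W ∧ c ∈ W ∧ PH ψ ∧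
      (∀ γ ∈ V, reg γ → stableOrbitalIntegralRel st m ψ γ = R γ) ∧ (∀ γ : A, reg γ → π γ ∈ W → ∃ γ' ∈ V, st γ γ')) :
    ∃ φH : A → ℂ, PH φH ∧ ∀ a : A, reg a → stableOrbitalIntegralRel st m φH a = R a := by
  refine exists_stableOrbitalIntegralRel_eq_of_locally st reg m π hπ hπst PH hPH0 hPHadd hPHcut R K hK hRK fun c hc => ?_
  obtain ⟨V, W, ψ, hWo, hcW, hψ, hV, hsat⟩ := hloc c hc
  exact ⟨W, ψ, hWo, hcW, hψ, forall_stableOrbitalIntegralRel_eq_of_saturation m π hst hreg hR hV hsat⟩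

end Saturation

end Literature.NumberTheory.Rogawski1990

end
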